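import Mathlib
import Literature.Computability.Complexity.CNF
import Literature.Computability.Complexity.CoinCounting
import Literature.Computability.Complexity.ApproximateCounting
import Summits.PneNP.PneNP.Theses.WitnessForging

/-!
# Route WitnessForging — support item `SatBridge` (stmt-PneNP-2432): the objects of the proof

Definitions used by the proof of `Summit.PneNP.PneNP.Theses.WitnessForging.SatBridge`
(almost-uniform generation of SAT witnesses from `NP ⊆ BPP`, Jerrum–Valiant–Vazirani 1986 via
Stockmeyer approximate counting). They are PROOF DEVICES, not objects the route posits; they are
collected in one small file so that the proof files that follow contain theorems only.

* `Sol φ` — the solution set of a CNF `φ` over `x₀ … x_{n-1}`, `n = numVars φ`, as bit strings of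
  length `n` (literally the set written in the route decls `SatBridge` / `ForgingThesis`);
* `extCount φ w` — the number of solutions extending the prefix `w` (`cnt` of `CoinCounting.lean`);
* `choiceBit N₀ N₁ L t` — the biased coin of the JVV sampler: with estimates `N₀, N₁` of the two
  extension counts and a uniform `t < 2^L`, the next bit is `1` iff `t · (N₀ + N₁) < N₁ · 2^L`;
* `estOf G c x n k w b u` — the estimate of the number of solutions extending `w·b`, read off an
  answer function `G` on Stockmeyer's counting query (`countQuery`, `ApproximateCounting.lean`) for
  the instance `⟨x, w·b⟩`, witness length `n - |w| - 1`, accuracy and confidence `k`, and the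
  prefix of the coin block `u` of the length `c(…)` the counter reads;
* `stepJVV`, `runJVV` — one round and the whole bit-by-bit sampler (a left fold over the coin
  blocks), abstract in the estimator;
* `samplerJVV` — the concrete sampler on a CNF code `x` with coin string `ω = r ++ blocks`: the
  estimator is an oracle-free string function `Fst ⟨query, ⟨1^P, r⟩⟩` (the oracle-eliminated
  Stockmeyer transducer of `WitnessForgingSatBridgeOracleElim.lean`), all size parameters being
  polynomials of `N = |x|`.

References: M. R. Jerrum, L. G. Valiant, V. V. Vazirani, TCS 43 (1986) 169–188, §3 (almost
uniform generation from approximate counting, self-reducibility); L. Stockmeyer, SIAM J. Comput. 14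
(1985); S. Arora, B. Barak, *Computational Complexity*, CUP 2009, §7.4.1, §17.1.
-/

set_option linter.dupNamespace false -- `Summit.PneNP.PneNP.…`: summit = sub-problem (D-0017)

namespace Summit.PneNP.PneNP.Theorems.SatBridgeJVV

open Literature.Computability.Complexity
open _root_.Computability

/-- **The solution set** of the CNF `φ` over the variables `x₀, …, x_{n-1}`, `n = numVars φ`, as bit
strings of length exactly `n` read as assignments (`y.getD i false`; unused low variables are free
bits). Literally the set `{y | y.length = φ.numVars ∧ φ.eval (fun i => y.getD i false) = true}` of
the route decls. [folklore] -/
def Sol (φ : CNF ℕ) : Set (List Bool) :=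
  {y : List Bool | y.length = φ.numVars ∧ φ.eval (fun i => y.getD i false) = true}

/-- **The extension count** of a prefix: the number of bit strings `z` of length `numVars φ - |w|`
with `w ++ z ∈ Sol φ` (for `|w| ≤ numVars φ`: the number of solutions with prefix `w`; the
self-reducibility counts of Jerrum–Valiant–Vazirani). [folklore] -/
noncomputable def extCount (φ : CNF ℕ) (w : List Bool) : ℕ :=
  cnt (φ.numVars - w.length) {z | w ++ z ∈ Sol φ}

/-- **The biased coin** of the sampler: from estimates `N₀, N₁` of the two extension counts and a
uniform number `t < 2^L`, output `1` iff `t · (N₀ + N₁) < N₁ · 2^L` (so that `Pr[1] ≥ N₁/(N₀+N₁)` and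
`Pr[0] ≥ N₀/(N₀+N₁) - 2^{-L}`). [folklore] -/
def choiceBit (N₀ N₁ L t : ℕ) : Bool :=
  decide (t * (N₀ + N₁) < N₁ * 2 ^ L)

/-- **The count estimate read off an answer function `G`** (Stockmeyer's transducer or its
oracle-free simulation): the answer of `G` on the counting query for the instance `⟨x, w·b⟩`, witness
length `m = n - |w| - 1`, accuracy `1/k`, confidence `1/k`, and the coin prefix of length
`c(|⟨x, w·b⟩| + m + k + k)` of the block `u`, read as a number (`decodeNat`, as in `countEstimate`).
[folklore] -/
def estOf (G : List Bool → List Bool) (c : Polynomial ℕ) (x : List Bool) (n k : ℕ)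
    (w : List Bool) (b : Bool) (u : List Bool) : ℕ :=
  decodeNat (G (countQuery (boolPair x (w ++ [b])) (n - w.length - 1) k k
    (u.take (c.eval ((boolPair x (w ++ [b])).length + (n - w.length - 1) + k + k)))))

/-- **One round of the JVV sampler**, abstract in the estimator `est w b u`: the coin block `blk`
is cut into two counter blocks of length `U` and a choice block of length `L`; the prefix `w` is
extended by the biased coin. [cite: JerrumValiantVazirani1986, §3] -/
def stepJVV (est : List Bool → Bool → List Bool → ℕ) (U L : ℕ) (w blk : List Bool) : List Bool :=
  w ++ [choiceBit (est w false (blk.take U)) (est w true ((blk.drop U).take U)) L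
    (bitsToNat ((blk.drop (2 * U)).take L))]

/-- **The JVV sampler**: `n` rounds of `stepJVV` over the first `n` coin blocks, from the empty
prefix. [cite: JerrumValiantVazirani1986, §3] -/
def runJVV (est : List Bool → Bool → List Bool → ℕ) (U L n : ℕ) (blocks : List (List Bool)) :
    List Bool :=
  (blocks.take n).foldl (stepJVV est U L) []

/-- **The concrete sampler** on the CNF code `x` (with `n` variables) and the coin string `ω`:
`N = |x|`; the first `T(N)` coins `r` drive the oracle-free estimator
`q ↦ Fst ⟨q, ⟨1^{P(N)}, r⟩⟩`; the remaining coins are cut into `N` blocks of length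
`2·U(N) + L(N)`, of which the first `n` are consumed by `runJVV` with accuracy/confidence
parameter `k(N)`. All of `kk, L, P, T, U` are polynomials. [cite: JerrumValiantVazirani1986, §3] -/
def samplerJVV (Fst : List Bool → List Bool) (c kk L P T U : Polynomial ℕ) (x : List Bool) (n : ℕ)
    (ω : List Bool) : List Bool :=
  runJVV
    (estOf (fun q => Fst (boolPair q (boolPair (unaryEncodeNat (P.eval x.length)) (ω.take (T.eval x.length)))))
      c x n (kk.eval x.length))
    (U.eval x.length) (L.eval x.length) n
    ((List.range x.length).map fun i =>
      ((ω.drop (T.eval x.length)).drop (i * (2 * U.eval x.length + L.eval x.length))).take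
        (2 * U.eval x.length + L.eval x.length))

end Summit.PneNP.PneNP.Theorems.SatBridgeJVV
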